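import Mathlib.LinearAlgebra.Matrix.Permanent
import Mathlib.LinearAlgebra.Matrix.ConjTranspose
import Mathlib.LinearAlgebra.UnitaryGroup
import Mathlib.Probability.ProbabilityMassFunction.Constructions
import Mathlib.Analysis.Complex.Basic
import Mathlib.Algebra.Order.Round
import Literature.Computability.Cryptography.StatisticalDistance
import Literature.Computability.Cryptography.OneWayFunctions
import Literature.Computability.Cryptography.QubitRegister
import Literature.Computability.Cryptography.QuantumCircuit
import Literature.Computability.Cryptography.ClassBQP
import Literature.Computability.Complexity.BoolEncodings
import Literature.Computability.Complexity.GraphEncodings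
import Literature.Computability.Complexity.Randomized
import Literature.Computability.Complexity.Oracle
import HarnessLib

-- provenance: harness21/H21/H21/Prelude/CryptoQuantFine/SamplingProblems.lean @ 42d7803 (interim HEAD d8f2665); M5 mechanical rewrite
/-!
# Sampling problems: SampP, SampBQP, IQP and BosonSampling (trunk CryptoQuantFine, outline Q6)

This prelude file realises the notion `sampling_problems` of the CryptoQuantFine outline:

* *sampling problems* `SamplingProblem := List Bool → PMF (List Bool)` (a family of target
  distributions `(D_x)_{x ∈ {0,1}*}`), the classes `SampP` and `SampBQP` of sampling problems
  approximately samplable (to total variation distance `1/k` on input `⟨x, 1^k⟩`) in classical resp.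
  quantum polynomial time;
* simulation predicates for a fixed classical sampler `A : RandAlg (List Bool) (List Bool)`:
  `A.ExactlySamples D`, `A.SamplesWithinTV D ε`, `A.SamplesMultiplicative D c`;
* IQP ("instantaneous quantum polynomial time") circuits `H^{⊗N} D H^{⊗N}` with `D` a circuit of
  diagonal gates over the gate set `iqpDiag = {Z, CZ, T}`, IQP families and their output kernel;
* BosonSampling: column-orthonormal `m × n` matrices, the outcome weights
  `|Per(A_s)|² / n!` on ordered mode lists `s : Fin n → Fin m` and the distribution
  `bosonSamplingPMF A`;
* the deterministic pieces of the *Gaussian permanent estimation* (GPE) oracle interface used by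
  the Permanent-of-Gaussians conjecture: dyadic complex numbers, rounding, the query encoder and
  the decoded integer answer of an oracle.

## Sources

* S. Aaronson, A. Arkhipov, *The computational complexity of linear optics*, Theory of Computing 9
  (2013), §1.1, Definitions 2.6–2.7 (sampling problems, `SampP`, `SampBQP`), §3 (BosonSampling),
  Theorem 3.10 and its footnote (normalisation), §1.2 and Conjecture 1.5 (GPE, PGC).
* S. Aaronson, *The equivalence of sampling and searching*, CSR 2011, §2 (`SampP`, `SampBQP`).
* M. J. Bremner, R. Jozsa, D. J. Shepherd, *Classical simulation of commuting quantum computations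
  implies collapse of the polynomial hierarchy*, Proc. R. Soc. A 467 (2011), §2 (IQP, weak
  simulation to multiplicative error).
* D. Shepherd, M. J. Bremner, *Temporally unstructured quantum computation*, Proc. R. Soc. A 465
  (2009) (IQP, X-programs).
* M. J. Bremner, A. Montanaro, D. J. Shepherd, *Average-case complexity versus approximate
  simulation of commuting quantum computations*, PRL 117 (2016) (IQP as `H^{⊗n} D H^{⊗n}` with
  `D` over `{Z, CZ, CCZ}` / `{√CZ, T}`).

## Mathlib

Used: `Matrix.permanent` (`Mathlib/LinearAlgebra/Matrix/Permanent.lean`), `Matrix.submatrix`,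
`Matrix.conjTranspose` (`ᴴ`), `Matrix.unitaryGroup`, `Matrix.mulVec`, `Matrix.of`, `Nat.factorial`,
`PMF`, `PMF.map`, `round`, `Complex.I`. Mathlib has no sampling complexity classes, no IQP, no
BosonSampling and no named predicate for `Aᴴ * A = 1` on rectangular matrices (searched:
`SampP`, `boson`, `IQP`, `columnOrthonormal`, `isometry` on `Matrix`); `Matrix.unitaryGroup` is
square only. From H21: `PMF.tvDist` (C1), `IsPPT` (C2), `QReg`, `basisState`, `padInput`,
`hGate`, `pauliZ`, `cz`, `tGate`, `QGateSet`, `cliffordT` (Q1), `QCircuit`, `QCircuit.mat`,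
`bornPMF`, `QCircuitFamily`, `QCircuitFamily.kernel/IsUniform/IsOracleFree`,
`QCircuit.sigmaEncode` (Q2), `RandAlg`, `RandAlg.outputPMF` (G01 Randomized), `boolPair`,
`encodingIntBool`, `Computability.Encoding.pairBool/sigmaBool` (G01 BoolEncodings),
`encodingFinVec` (G01 GraphEncodings), `Oracle` (G01 Oracle), `PolyTimeComputable` (G01
TimeBounds).

## Design choices

* The accuracy parameter of `SampP`/`SampBQP` is an integer `k ≥ 1` given in unary (`ε = 1/k`),
  as in Aaronson–Arkhipov's `⟨x, 0^{1/ε}⟩`; the sampler's input is `boolPair x (unaryEncodeNat k)`.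
* `SampBQP` is realised by a poly-time uniform, oracle-free Clifford+T circuit family measured on
  all wires, followed by a deterministic polynomial-time classical post-processing
  `post : List Bool → List Bool` of the measured string. The post-processing is indispensable:
  the raw kernel of a circuit family outputs strings of a *fixed* length depending on `(x, k)`,
  whereas the target `D x` does not depend on `k`; Aaronson's "polynomial-time quantum algorithm"
  is a hybrid machine and in particular may discard workspace.
* The simulation predicates and `samplePMF` for classical samplers are deliberate dot-notation
  extensions in the namespace `Literature.Computability.Complexity.RandAlg` (so that `A.ExactlySamples D`,
  `A.samplePMF x k` read as in G10's statement files); everything else is in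
  `Literature.CryptoQuantFine`.
* IQP: the diagonal part is a `QCircuit iqpDiag N` in the sense of Q2 (so uniformity is Q2's
  `sigmaEncode`-uniformity verbatim); `H^{⊗N}` is given in closed form (`hGateAll`).
* BosonSampling outcomes are *ordered* mode assignments `s : Fin n → Fin m` with weight
  `|Per(A_s)|²/n!`, `A_s` the `n × n` matrix with rows `A_{s 1}, …, A_{s n}`; pushing forward to
  multisets `Sym (Fin m) n` gives Aaronson–Arkhipov's `|Per(A_S)|² / (s₁! ⋯ s_m!)`.
  `bosonSamplingPMF` is the normalised Born distribution of the amplitude vector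
  `s ↦ Per(A_s)/√n!`; junk value (from `bornPMF`): uniform if all permanents vanish, which never
  happens for column-orthonormal `A` (`sum_bosonWeight_eq_one`).
* GPE: only the deterministic, encoding-level pieces live here; the measure-theoretic success
  predicate of a GPE oracle (over Wave0's `gaussianMatrixMeasure`) lives in the statement file.
  `GPEOracleEstimate` decodes the oracle's answer with `encodingIntBool`, malformed answers ↦ `0`
  (junk, documented).
-/

open Matrix Computability Literature.Computability.Complexity

namespace Literature.Computability.Cryptography

/-! ### Sampling problems and `SampP` -/

/-- A *sampling problem*: a family `(D_x)_{x ∈ {0,1}*}` of probability distributions over bit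
strings, indexed by the input `x`. (Aaronson–Arkhipov 2013, Def. 2.6; Aaronson 2011, §2.) [cite: AaronsonArkhipov2013, Def. 2.6] -/
abbrev SamplingProblem : Type := List Bool → PMF (List Bool)

end Literature.Computability.Cryptography

namespace Literature.Computability.Complexity.RandAlg

open Cryptography

/-- `A.samplePMF x k`: the output distribution of the classical sampler `A` on input `⟨x, 1^k⟩`
(`boolPair x (unaryEncodeNat k)`), where `k` plays the role of `⌈1/ε⌉`. Deliberate dot-notation
extension of `Literature.Computability.Complexity.RandAlg`. (Aaronson–Arkhipov 2013, Def. 2.7: input `⟨x, 0^{1/ε}⟩`.) [cite: AaronsonArkhipov2013, Def. 2.7: input  ⟨x  0^{1/ε}⟩] -/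
noncomputable def samplePMF (A : RandAlg (List Bool) (List Bool)) (x : List Bool) (k : ℕ) :
    PMF (List Bool) :=
  A.outputPMF id (boolPair x (unaryEncodeNat k))

/-- `A.ExactlySamples D`: the classical sampler `A` samples *exactly* from the target family,
`A(x) = D_x` for every input `x`. Deliberate dot-notation extension of `Literature.Computability.Complexity.RandAlg`.
(Aaronson–Arkhipov 2013, §1.1 (exact BosonSampling); Bremner–Jozsa–Shepherd 2011, §2.) [cite: AaronsonArkhipov2013, §1.1 (exact BosonSampling] -/
def ExactlySamples (A : RandAlg (List Bool) (List Bool)) (D : SamplingProblem) : Prop :=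
  ∀ x, A.outputPMF id x = D x

/-- `A.SamplesWithinTV D ε`: on every input `x` the output distribution of `A` is within total
variation distance `ε` of `D_x`. Deliberate dot-notation extension of `Literature.Computability.Complexity.RandAlg`.
(Aaronson–Arkhipov 2013, §1.1 (approximate sampling), Def. 2.7.) [cite: AaronsonArkhipov2013, §1.1 (approximate sampling] -/
def SamplesWithinTV (A : RandAlg (List Bool) (List Bool)) (D : SamplingProblem) (ε : ℝ) : Prop :=
  ∀ x, (A.outputPMF id x).tvDist (D x) ≤ ε

/-- `A.SamplesMultiplicative D c`: `A` weakly simulates `D` to within multiplicative error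
`c ≥ 1`, i.e. `D_x(y)/c ≤ Pr[A(x) = y] ≤ c · D_x(y)` for all `x, y`. Deliberate dot-notation
extension of `Literature.Computability.Complexity.RandAlg`. (Bremner–Jozsa–Shepherd 2011, §2, eq. (2).) [cite: BremnerJozsaShepherd2011, §2  eq. (2] -/
def SamplesMultiplicative (A : RandAlg (List Bool) (List Bool)) (D : SamplingProblem) (c : ℝ) :
    Prop :=
  ∀ x y, (D x y).toReal / c ≤ (A.outputPMF id x y).toReal ∧
    (A.outputPMF id x y).toReal ≤ c * (D x y).toReal

/-- Exact sampling is sampling within total variation distance `ε` for every `ε ≥ 0`.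
(Aaronson–Arkhipov 2013, §1.1.) [cite: AaronsonArkhipov2013, §1.1] -/
theorem ExactlySamples.samplesWithinTV {A : RandAlg (List Bool) (List Bool)} {D : SamplingProblem}
    (h : A.ExactlySamples D) {ε : ℝ} (hε : 0 ≤ ε) : A.SamplesWithinTV D ε := by
  intro x
  rw [h x, PMF.tvDist_self]
  exact hε

/-- Exact sampling is multiplicative-error sampling with `c = 1`.
(Bremner–Jozsa–Shepherd 2011, §2.) [cite: BremnerJozsaShepherd2011, §2] -/
theorem ExactlySamples.samplesMultiplicative_one {A : RandAlg (List Bool) (List Bool)}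
    {D : SamplingProblem} (h : A.ExactlySamples D) : A.SamplesMultiplicative D 1 := by
  intro x y
  simp [h x]

end Literature.Computability.Complexity.RandAlg

namespace Literature.Computability.Cryptography

/-- **SampP**: sampling problems `D` for which some probabilistic polynomial-time algorithm `A`,
given `⟨x, 1^k⟩` (`k ≥ 1`), outputs a sample from a distribution within total variation distance
`1/k` of `D_x`. (Aaronson–Arkhipov 2013, Def. 2.7; Aaronson 2011, §2.) [cite: AaronsonArkhipov2013, Def. 2.7] -/
def SampP : Set SamplingProblem :=
  {D | ∃ A : RandAlg (List Bool) (List Bool), IsPPT A id ∧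
    ∀ x k, 0 < k → (A.samplePMF x k).tvDist (D x) ≤ 1 / (k : ℝ)}

namespace QCircuitFamily

variable {G : QGateSet}

/-- `F.samplePMF x k`: the raw classical output kernel (empty oracle, all wires measured) of the
circuit family `F` on the input `⟨x, 1^k⟩ = boolPair x (unaryEncodeNat k)`.
(Aaronson–Arkhipov 2013, Def. 2.7; H21 `QCircuitFamily.kernel`.) [cite: AaronsonArkhipov2013, Def. 2.7] -/
noncomputable def samplePMF (F : QCircuitFamily G) (x : List Bool) (k : ℕ) : PMF (List Bool) :=
  F.kernel 0 (boolPair x (unaryEncodeNat k))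

end QCircuitFamily

/-- **SampBQP**: sampling problems `D` for which some poly-time uniform, oracle-free family of
Clifford+T circuits, run on `|⟨x, 1^k⟩⟩|0…0⟩` and measured on all wires, followed by a
deterministic polynomial-time classical post-processing `post` of the measured string, outputs a
sample within total variation distance `1/k` of `D_x` (`k ≥ 1`). See the module docstring for why
`post` is part of the definition. (Aaronson–Arkhipov 2013, Def. 2.7; Aaronson 2011, §2.) [cite: AaronsonArkhipov2013, Def. 2.7] -/
def SampBQP : Set SamplingProblem :=
  {D | ∃ (F : QCircuitFamily cliffordT) (post : List Bool → List Bool),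
    F.IsOracleFree ∧ F.IsUniform ∧
    PolyTimeComputable (id : List Bool → List Bool) (id : List Bool → List Bool) post ∧
    ∀ x k, 0 < k → ((F.samplePMF x k).map post).tvDist (D x) ≤ 1 / (k : ℝ)}

/-- `SampP ⊆ SampBQP`: a classical PPT sampler is simulated by a uniform quantum circuit family
(coins from Hadamard-and-measure, reversible simulation of the deterministic part).
(Aaronson–Arkhipov 2013, §2 — the classes are "Def. 2.7" in the numbering used when this file
was vendored and Def. 2.3, p. 162, in the Theory of Computing version held in the literature
store; Nielsen–Chuang §4.5.5, §1.4.1.)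

**Mis-stated — false as formalised; do not consume `(h : SampP_subset_SampBQP)`.** The tree's
`SampP` quantifies over `RandAlg`s with `IsPPT A id`, which only *bounds* the coin budget
`A.coinLen : ℕ → ℕ` (otherwise arbitrary data), while `RandAlg.outputPMF` feeds `A.run` exactly
`coinLen |⟨x, 1^k⟩|` coins, which it can count; with a non-computable coin budget formal `SampP`
therefore contains sampling problems whose point-mass targets encode a non-computable function,
whereas every member of `SampBQP` (polynomial-time uniform family, polynomial-time
post-processing) has computable output laws — the counterexample is spelled out in
`SamplingProblemsUniform.lean` (module docstring), and the same defect is recorded at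
`Literature.Computability.Complexity.mem_BPP_iff_randAlg` and for quantum-advantage S20–S22. The source's `SampP` is
a class of *uniform* machines: the corrected statement, with the exact-polynomial coin budget
`∃ q, ∀ n, A.coinLen n = q.eval n` (`UniformSampP`), is
`Literature.Computability.Cryptography.UniformSampP_subset_SampBQP` (`SamplingProblemsUniform.lean`), **proved** there
(`UniformSampP_subset_SampBQP_holds`); the present declaration implies it
(`UniformSampP_subset_SampBQP_of_sampP_subset`) and is kept, unchanged, only because it is
vendored under this name. [cite: AaronsonArkhipovToC2013, Def. 2.3 (p. 162)] -/
def SampP_subset_SampBQP : Prop :=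
  SampP ⊆ SampBQP

/-! ### IQP circuits -/

/-- The gate symbols of the diagonal IQP gate set `{Z, CZ, T}`. (Bremner–Jozsa–Shepherd 2011, §2;
Bremner–Montanaro–Shepherd 2016.) [cite: BremnerJozsaShepherd2011, §2] -/
inductive IQPOp
  | Z
  | CZ
  | T
  deriving DecidableEq, Fintype, Inhabited

/-- `IQPOp` is encodable (needed for uniformity of IQP families), via `Fin 3`. [folklore] -/
instance : Encodable IQPOp := Encodable.ofEquiv (Fin 3)
  { toFun := fun g => match g with | .Z => 0 | .CZ => 1 | .T => 2
    invFun := fun i => match i with | 0 => .Z | 1 => .CZ | 2 => .T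
    left_inv := fun g => by cases g <;> rfl
    right_inv := fun i => by fin_cases i <;> rfl }

/-- The diagonal IQP gate set `{Z, CZ, T}` (arities `1, 2, 1`): all gates are diagonal in the
computational basis, so circuits over it commute. (Bremner–Jozsa–Shepherd 2011, §2;
Bremner–Montanaro–Shepherd 2016.) [cite: BremnerJozsaShepherd2011, §2] -/
noncomputable def iqpDiag : QGateSet where
  Op := IQPOp
  arity
    | .Z => 1
    | .CZ => 2
    | .T => 1
  mat
    | .Z => pauliZ
    | .CZ => cz
    | .T => tGate

/-- `iqpDiag.Op` is `IQPOp`, hence encodable. [folklore] -/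
noncomputable instance : Encodable iqpDiag.Op := inferInstanceAs (Encodable IQPOp)

/-- The diagonal IQP gate set is unitary. (Nielsen–Chuang §4.2.) [folklore] -/
def iqpDiag_isUnitary : Prop :=
  iqpDiag.IsUnitary

/- interim proof relied on results that are now named facts (D-0014); demoted to a fact by the M5 import, proof preserved:
:= by
  rintro (_ | _ | _)
  · exact pauliZ_mem_unitaryGroup
  · exact cz_mem_unitaryGroup
  · exact tGate_mem_unitaryGroup
-/

/-- The `n`-fold tensor power of the Hadamard gate, `H^{⊗n}`, in closed form:
`⟨x| H^{⊗n} |y⟩ = 2^{-n/2} (-1)^{x · y}` with `x · y = #{i | xᵢ = yᵢ = 1}`.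
(Nielsen–Chuang §1.4.4, eq. (1.50); Bremner–Jozsa–Shepherd 2011, §2.) [cite: BremnerJozsaShepherd2011, §2] -/
noncomputable def hGateAll (n : ℕ) : Matrix (QReg n) (QReg n) ℂ :=
  Matrix.of fun x y =>
    ((Real.sqrt 2 : ℂ)⁻¹) ^ n * (-1) ^ (Finset.univ.filter fun i => x i = true ∧ y i = true).card

/-- `H^{⊗n}` is unitary. (Nielsen–Chuang §1.4.4.) [cite: NielsenChuang2010, §1.4.4 (H^{⊗n} is unitary as a tensor power of the unitary H)] -/
def hGateAll_mem_unitaryGroup : Prop :=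
  ∀ (n : ℕ),
    hGateAll n ∈ Matrix.unitaryGroup (QReg n) ℂ

/-- The sign `(-1)^{x · y}` of `H^{⊗n}` as a product of per-coordinate signs
`∏ᵢ (-1)^{xᵢ yᵢ}`. (Nielsen–Chuang §1.4.4, eq. (1.50): `(-1)^{x₁z₁ + ⋯ + xₙzₙ}`.) [cite: NielsenChuang2010, §1.4.4 eq. (1.50)] -/
theorem neg_one_pow_card_filter_and {n : ℕ} (x y : QReg n) :
    (-1 : ℂ) ^ (Finset.univ.filter fun i => x i = true ∧ y i = true).card
      = ∏ i, (if x i = true ∧ y i = true then (-1 : ℂ) else 1) := by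
  rw [Finset.prod_ite, Finset.prod_const_one, mul_one, Finset.prod_const]

/-- Per-coordinate orthogonality of the Hadamard signs: `∑_{b ∈ {0,1}} (-1)^{ab} (-1)^{bc} = 2·[a = c]`,
i.e. the single-qubit identity `H² = I` entrywise (up to the factor `2`).
(Nielsen–Chuang §1.4.4, `H|x⟩ = ∑_z (-1)^{xz}|z⟩/√2`; Ex. 2.33.) [cite: NielsenChuang2010, §1.4.4 and Exercise 2.33] -/
theorem sum_bool_hadamardSign (a c : Bool) :
    ∑ b : Bool, (if a = true ∧ b = true then (-1 : ℂ) else 1) *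
        (if b = true ∧ c = true then (-1 : ℂ) else 1)
      = if a = c then 2 else 0 := by
  cases a <;> cases c <;> norm_num

/-- The normalisation constant of `H^{⊗n} · H^{⊗n}`: `(1/√2)^n · (1/√2)^n · 2^n = 1`. [folklore] -/
theorem sqrt_two_inv_pow_mul_pow_mul_two_pow (n : ℕ) :
    ((Real.sqrt 2 : ℂ)⁻¹) ^ n * ((Real.sqrt 2 : ℂ)⁻¹) ^ n * 2 ^ n = 1 := by
  rw [← mul_pow, ← mul_pow, ← mul_inv, ← Complex.ofReal_mul,
    Real.mul_self_sqrt (by norm_num : (0:ℝ) ≤ 2)]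
  simp

/-- Entries of `H^{⊗n} · H^{⊗n}`:
`∑_y 2^{-n} (-1)^{x·y} (-1)^{y·z} = 2^{-n} ∏ᵢ ∑_b (-1)^{xᵢb}(-1)^{b zᵢ} = 2^{-n} ∏ᵢ 2[xᵢ = zᵢ] = [x = z]`
(product of sums, `Fintype.prod_sum`). (Nielsen–Chuang Ex. 2.33, eq. (2.55).) [cite: NielsenChuang2010, Exercise 2.33 eq. (2.55)] -/
theorem hGateAll_mul_self_apply (n : ℕ) (x z : QReg n) :
    (hGateAll n * hGateAll n) x z = if x = z then 1 else 0 := by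
  have hterm : ∀ y : QReg n, hGateAll n x y * hGateAll n y z =
      ((Real.sqrt 2 : ℂ)⁻¹) ^ n * ((Real.sqrt 2 : ℂ)⁻¹) ^ n *
        ∏ i, ((if x i = true ∧ y i = true then (-1 : ℂ) else 1) *
          (if y i = true ∧ z i = true then (-1 : ℂ) else 1)) := by
    intro y
    rw [Finset.prod_mul_distrib, ← neg_one_pow_card_filter_and, ← neg_one_pow_card_filter_and]
    simp only [hGateAll, Matrix.of_apply]
    ring
  have hps : ∑ y : QReg n, ∏ i, ((if x i = true ∧ y i = true then (-1 : ℂ) else 1) *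
        (if y i = true ∧ z i = true then (-1 : ℂ) else 1))
      = ∏ i : Fin n, (if x i = z i then (2 : ℂ) else 0) :=
    (Fintype.prod_sum fun i b => (if x i = true ∧ b = true then (-1 : ℂ) else 1) *
        (if b = true ∧ z i = true then (-1 : ℂ) else 1)).symm.trans
      (Finset.prod_congr rfl fun i _ => sum_bool_hadamardSign (x i) (z i))
  rw [Matrix.mul_apply, Finset.sum_congr rfl (fun y _ => hterm y), ← Finset.mul_sum, hps,
    Fintype.prod_ite_zero, Finset.prod_const, Finset.card_univ, Fintype.card_fin]
  by_cases h : x = z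
  · subst h
    rw [if_pos (fun _ => rfl), if_pos rfl, sqrt_two_inv_pow_mul_pow_mul_two_pow]
  · rw [if_neg h, if_neg (fun h' => h (funext h')), mul_zero]

/-- `H^{⊗n} · H^{⊗n} = 1` (`H^{⊗n}` is an involution, as `H² = I`).
(Nielsen–Chuang Ex. 2.33, eq. (2.55); §4.2, `H = (X + Z)/√2`, `H² = I`.) [cite: NielsenChuang2010, Exercise 2.33 eq. (2.55)] -/
theorem hGateAll_mul_self (n : ℕ) : hGateAll n * hGateAll n = 1 := by
  ext x z
  rw [hGateAll_mul_self_apply, Matrix.one_apply]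

/-- `H^{⊗n}` is self-adjoint: its closed form (2.55) is real and symmetric in `x, y`.
(Nielsen–Chuang Ex. 2.33, eq. (2.55).) [cite: NielsenChuang2010, Exercise 2.33 eq. (2.55)] -/
theorem hGateAll_conjTranspose (n : ℕ) : (hGateAll n)ᴴ = hGateAll n := by
  ext x y
  have h : (Finset.univ.filter fun i => y i = true ∧ x i = true)
      = Finset.univ.filter fun i => x i = true ∧ y i = true :=
    Finset.filter_congr fun i _ => and_comm
  simp [hGateAll, Matrix.conjTranspose_apply, h]

/-- **Discharge** of `hGateAll_mem_unitaryGroup`: `H^{⊗n}` is unitary, since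
`H^{⊗n} (H^{⊗n})† = H^{⊗n} H^{⊗n} = 1` (`hGateAll_conjTranspose`, `hGateAll_mul_self`). The book's
argument (H unitary, §1.3.1/§2.1.10 with Ex. 2.29: tensor products of unitaries are unitary) is
replaced by the direct computation on the closed form (2.55), which is how `hGateAll` is defined.
(Nielsen–Chuang §1.4.4, eq. (1.50); Ex. 2.33, eq. (2.55); Ex. 2.29.) [cite: NielsenChuang2010, §1.4.4 eq. (1.50) and Exercise 2.33 eq. (2.55)] -/
theorem hGateAll_mem_unitaryGroup_holds : hGateAll_mem_unitaryGroup := by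
  intro n
  rw [Matrix.mem_unitaryGroup_iff, Matrix.star_eq_conjTranspose, hGateAll_conjTranspose,
    hGateAll_mul_self]

/-- `H^{⊗1}` is the Hadamard gate. (Nielsen–Chuang §1.3.1.) [folklore] -/
theorem hGateAll_one_apply (x y : QReg 1) : hGateAll 1 x y = hGate x y := by
  by_cases h : x 0 = true ∧ y 0 = true <;> simp [hGateAll, hGate, h, Finset.filter_singleton]

/-- The unitary of an IQP circuit with diagonal part `D` on `N` wires: `H^{⊗N} · U_D · H^{⊗N}`.
(Bremner–Jozsa–Shepherd 2011, §2; Shepherd–Bremner 2009.) [cite: BremnerJozsaShepherd2011, §2] -/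
noncomputable def iqpUnitary {N : ℕ} (D : QCircuit iqpDiag N) : Matrix (QReg N) (QReg N) ℂ :=
  hGateAll N * D.mat * hGateAll N

/-- IQP unitaries are unitary. (Bremner–Jozsa–Shepherd 2011, §2.) [cite: BremnerJozsaShepherd2011, §2] -/
def iqpUnitary_mem_unitaryGroup : Prop :=
  ∀ {N : ℕ} (D : QCircuit iqpDiag N),
    iqpUnitary D ∈ Matrix.unitaryGroup (QReg N) ℂ

/-- A family of IQP circuits: for each input length `n`, a number `ancillas n` of ancilla wires and
the diagonal part `diag n`, a circuit over `iqpDiag` on `n + ancillas n` wires; the circuit run is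
`H^{⊗N} U_{diag n} H^{⊗N}` on `|x⟩|0…0⟩` followed by measurement of all wires.
(Bremner–Jozsa–Shepherd 2011, §2; Bremner–Montanaro–Shepherd 2016.) [cite: BremnerJozsaShepherd2011, §2] -/
structure IQPFamily where
  /-- The number of ancilla wires used on inputs of length `n`. -/
  ancillas : ℕ → ℕ
  /-- The diagonal part of the IQP circuit on inputs of length `n`. -/
  diag : (n : ℕ) → QCircuit iqpDiag (n + ancillas n)

namespace IQPFamily

/-- The underlying Q2 circuit family of the diagonal parts. [folklore] -/
def toQCircuitFamily (F : IQPFamily) : QCircuitFamily iqpDiag where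
  ancillas := F.ancillas
  circ := F.diag

/-- **Polynomial-time uniformity** of an IQP family: `1^n ↦ ⟨n, ancillas n, diag n⟩` is
polynomial-time computable (Q2's `QCircuitFamily.IsUniform` for the diagonal parts, output under
`QCircuit.sigmaEncode`). (Bremner–Jozsa–Shepherd 2011, §2 ("uniform families of IQP circuits").) [cite: BremnerJozsaShepherd2011, §2 ("uniform families of IQP circuits"] -/
def IsUniform (F : IQPFamily) : Prop :=
  F.toQCircuitFamily.IsUniform

/-- The output kernel of an IQP family, a sampling problem: on input `x`, apply
`H^{⊗N} U_{diag |x|} H^{⊗N}` (`N = |x| + ancillas |x|`) to `|x⟩|0…0⟩`, measure all wires (Born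
rule, `bornPMF`) and output the resulting bit string. (Bremner–Jozsa–Shepherd 2011, §2.) [cite: BremnerJozsaShepherd2011, §2] -/
noncomputable def kernel (F : IQPFamily) : SamplingProblem := fun x =>
  (bornPMF (iqpUnitary (F.diag x.length) *ᵥ
    basisState (padInput x.get (F.ancillas x.length)))).map List.ofFn

end IQPFamily

/-! ### BosonSampling -/

section BosonSampling

variable {m n : ℕ}

/-- `IsColumnOrthonormal A`: the `m × n` complex matrix `A` has orthonormal columns, `Aᴴ A = 1ₙ`
(the set `𝒰_{m,n}` of Aaronson–Arkhipov). For square matrices this is membership in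
`Matrix.unitaryGroup`. (Aaronson–Arkhipov 2013, §1.1 and §3.) [cite: AaronsonArkhipov2013, §1.1 and §3] -/
def IsColumnOrthonormal (A : Matrix (Fin m) (Fin n) ℂ) : Prop :=
  Aᴴ * A = 1

/-- The BosonSampling weight of the ordered mode assignment `s : Fin n → Fin m` (photon `i` is
found in mode `s i`): `|Per(A_s)|² / n!`, where `A_s = A.submatrix s id` is the `n × n` matrix whose
`i`-th row is row `s i` of `A`. Summing over the `n!/∏ⱼ sⱼ!` orderings of a multiset `S` gives
Aaronson–Arkhipov's `Pr[S] = |Per(A_S)|² / (s₁! ⋯ s_m!)`. (Aaronson–Arkhipov 2013, §1.1, eq. (1.3),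
and §3.) [cite: AaronsonArkhipov2013, §1.1  eq. (1.3] -/
noncomputable def bosonWeight (A : Matrix (Fin m) (Fin n) ℂ) (s : Fin n → Fin m) : ℝ :=
  ‖(A.submatrix s id).permanent‖ ^ 2 / n.factorial

/-- **The BosonSampling distribution** `𝒟_A` on ordered mode assignments `Fin n → Fin m`: the
normalised Born distribution of the amplitude vector `s ↦ Per(A_s) / √(n!)`. For column-orthonormal
`A` with `n ≤ m` no normalisation takes place (`bosonSamplingPMF_apply`); junk value (all
permanents zero): uniform. `[NeZero m]` supplies `Nonempty (Fin n → Fin m)`.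
(Aaronson–Arkhipov 2013, §1.1, eq. (1.3), §3, Thm. 3.10.) [cite: AaronsonArkhipov2013, §1.1  eq. (1.3] -/
noncomputable def bosonSamplingPMF [NeZero m] (A : Matrix (Fin m) (Fin n) ℂ) : PMF (Fin n → Fin m) :=
  bornPMF fun s => (A.submatrix s id).permanent / (Real.sqrt n.factorial : ℂ)

/-- BosonSampling weights are nonnegative. (Aaronson–Arkhipov 2013, §3.) [cite: AaronsonArkhipov2013, §3] -/
theorem bosonWeight_nonneg (A : Matrix (Fin m) (Fin n) ℂ) (s : Fin n → Fin m) :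
    0 ≤ bosonWeight A s :=
  div_nonneg (sq_nonneg _) (Nat.cast_nonneg _)

/-- BosonSampling weights are invariant under reordering the photons: `w(s ∘ σ) = w(s)` (the
permanent is invariant under row permutations). (Aaronson–Arkhipov 2013, §3; Mathlib
`Matrix.permanent_permute_cols`, whose `submatrix σ id` permutes rows in our orientation.) [cite: AaronsonArkhipov2013, §3] -/
theorem bosonWeight_comp_perm (A : Matrix (Fin m) (Fin n) ℂ) (s : Fin n → Fin m)
    (σ : Equiv.Perm (Fin n)) : bosonWeight A (s ∘ σ) = bosonWeight A s := by
  unfold bosonWeight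
  rw [show A.submatrix (s ∘ σ) id = (A.submatrix s id).submatrix σ id from rfl,
    Matrix.permanent_permute_cols]

/-- **Normalisation.** For column-orthonormal `A` (`n ≤ m`) the BosonSampling weights sum to `1`
over ordered mode assignments (equivalently, `∑_S |Per(A_S)|²/∏ sⱼ! = 1` over multisets).
(Aaronson–Arkhipov 2013, Thm. 3.10 and footnote.) [cite: AaronsonArkhipov2013, Thm. 3.10 and footnote] -/
def sum_bosonWeight_eq_one : Prop :=
  ∀ {A : Matrix (Fin m) (Fin n) ℂ} (hA : IsColumnOrthonormal A) (h : n ≤ m),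
    ∑ s : Fin n → Fin m, bosonWeight A s = 1

/-- For column-orthonormal `A` the BosonSampling distribution assigns to `s` exactly the weight
`|Per(A_s)|²/n!`. (Aaronson–Arkhipov 2013, §1.1, eq. (1.3), Thm. 3.10.) [cite: AaronsonArkhipov2013, §1.1  eq. (1.3] -/
def bosonSamplingPMF_apply : Prop :=
  ∀ [NeZero m] {A : Matrix (Fin m) (Fin n) ℂ} (hA : IsColumnOrthonormal A) (h : n ≤ m) (s : Fin n → Fin m),
    bosonSamplingPMF A s = ENNReal.ofReal (bosonWeight A s)

end BosonSampling

/-! ### Gaussian permanent estimation: encodings -/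

/-- The dyadic Gaussian rational `(z₁ + z₂ i) / 2^b ∈ ℂ` represented by `z = (z₁, z₂)` at
precision `b`. (Aaronson–Arkhipov 2013, §1.2 (inputs of `GPE` given to `poly(n)` bits).) [cite: AaronsonArkhipov2013, §1.2 (inputs of  GPE  given to  poly(n] -/
noncomputable def dyadicComplex (b : ℕ) (z : ℤ × ℤ) : ℂ :=
  ((z.1 : ℂ) + (z.2 : ℂ) * Complex.I) / 2 ^ b

/-- Rounding a complex number to precision `b`: the pair of nearest integers to `2^b · re w` and
`2^b · im w` (Mathlib `round`), so that `dyadicComplex b (roundDyadic b w)` is within `2^{-b}` of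
`w` in each coordinate. (Aaronson–Arkhipov 2013, §1.2.) [cite: AaronsonArkhipov2013, §1.2] -/
noncomputable def roundDyadic (b : ℕ) (w : ℂ) : ℤ × ℤ :=
  (round (2 ^ b * w.re), round (2 ^ b * w.im))

/-- Entrywise rounding of a complex matrix to precision `b`. (Aaronson–Arkhipov 2013, §1.2.) [cite: AaronsonArkhipov2013, §1.2] -/
noncomputable def roundMatrix {n : ℕ} (b : ℕ) (X : Matrix (Fin n) (Fin n) ℂ) :
    Matrix (Fin n) (Fin n) (ℤ × ℤ) :=
  X.map (roundDyadic b)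

/-- Boolean encoding of square matrices of integer pairs of size `n` (row-major, via G01's
`encodingFinVec` twice over `encodingIntBool.pairBool encodingIntBool`).
(Arora–Barak 2009, §0.1; H21 `encodingFinVec`.) [cite: AroraBarak2009, §0.1] -/
def encodingIntPairMatrix (n : ℕ) : Encoding (Fin n → Fin n → ℤ × ℤ) Bool :=
  encodingFinVec (encodingFinVec (encodingIntBool.pairBool encodingIntBool) n) n

/-- Boolean encoding of GPE queries `⟨n, b, k_ε, k_δ, X̃⟩`: the dimension `n`, the precision `b`,
the accuracy parameters `k_ε = ⌈1/ε⌉`, `k_δ = ⌈1/δ⌉` (binary) and the rounded matrix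
`X̃ : Fin n → Fin n → ℤ × ℤ`, assembled with G01's `sigmaBool`/`pairBool`.
(Aaronson–Arkhipov 2013, §1.2, Problem `|GPE|²_±`; Arora–Barak 2009, §0.1.) [cite: AaronsonArkhipov2013, §1.2  Problem  |GPE|²_±] -/
def encodingGPEQuery : Encoding (Σ n : ℕ, ℕ × ℕ × ℕ × (Fin n → Fin n → ℤ × ℤ)) Bool :=
  Encoding.sigmaBool fun n =>
    encodingNatBool.pairBool (encodingNatBool.pairBool
      (encodingNatBool.pairBool (encodingIntPairMatrix n)))

/-- The raw encoder of GPE queries (`encodingGPEQuery.encode`), the string handed to a GPE oracle.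
(Aaronson–Arkhipov 2013, §1.2.) [cite: AaronsonArkhipov2013, §1.2] -/
def encodeGPEQuery : (Σ n : ℕ, ℕ × ℕ × ℕ × (Fin n → Fin n → ℤ × ℤ)) → List Bool :=
  encodingGPEQuery.encode

/-- `encodeGPEQuery` is injective. [folklore] -/
theorem encodeGPEQuery_injective : Function.Injective encodeGPEQuery :=
  encodingGPEQuery.encode_injective

/-- `GPEOracleEstimate O n b kε kδ X̃`: the integer answer of the oracle `O` on the GPE query
`⟨n, b, kε, kδ, X̃⟩`, decoded with `encodingIntBool` (an estimate of `2^{2b} |Per X̃|²`-type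
quantities; the success semantics is fixed in the statement file). Junk value: a malformed answer
decodes to `0`. (Aaronson–Arkhipov 2013, §1.2, Conjecture 1.5.) [cite: AaronsonArkhipov2013, §1.2  Conjecture 1.5] -/
def GPEOracleEstimate (O : Oracle) (n b kε kδ : ℕ) (X : Matrix (Fin n) (Fin n) (ℤ × ℤ)) : ℤ :=
  (encodingIntBool.decode (O (encodeGPEQuery ⟨n, b, kε, kδ, X⟩))).getD 0

end Literature.Computability.Cryptography
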